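/-
Origin: expansion seat `planner-pub-hodgecm-toy2-g4-0`, handover #1b 2026-08-18T07:41:14Z (`HOME/pub-hodgecm-toy2-g4/lean/Toy2g4/ToyPadH6.lean`, md5 3bcea464, 144 lines);
landed by the gen-7 packager in gate run 26 as `HodgeCM/Model/Toy/ToyPadH6.lean` (import ^import Toy2g4\.PadH6\b(?!A)→import HodgeCM.Model.PadH6 ×1).
-/
/-
Copyright: pub-hodgecm formalisation cell (harness21, 2026). New file (not vendored).
Origin: HOME/pub-hodgecm-toy2-g4/lean/Toy2g4/ToyPadH6.lean — session planner-pub-hodgecm-toy2-g4-0 (unit pub-hodgecm-toy2-g4,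
CONSISTENCY seat 2, part (6a)(ii), generation 4).  WIP module `Toy2g4.ToyPadH6`; intended final place
`HodgeCM/Model/Toy/ToyPadH6.lean` (module `HodgeCM.Model.Toy.ToyPadH6`).
WIP import to rewrite on landing: `import Toy2g4.PadH6` ↦ `import HodgeCM.Model.PadH6` (this seat, same handover).
-/
import Summits.HodgeConjecture.HodgeCM.Model.PadH6_3
import Summits.HodgeConjecture.HodgeCM.Model.Toy.ToyTruncAlg
import Summits.HodgeConjecture.HodgeCM.Model.Toy.ToyGysinDescent

/-!
# The padded toy universe: a model of the 28 facts + N2–N4 in which Pohlmann's span theorem FAILS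

`padModel := toyModel.padH6` (`HodgeCM.Model.PadH6` applied to the exterior toy universe `HodgeCM.Toy.toyModel`).
Its truth table (`padModel_profile`), all kernel-checked, no hypotheses:

| statement                                   | `toyModel` | `truncModel` | `padModel` |
|---------------------------------------------|:----------:|:------------:|:----------:|
| `ModelAxioms` (M1–M28)                      | ✓          | ✓            | ✓          |
| N2 `Fact_cup_hodge`, N3, N4, F4, F5, dimProd | ✓          | ✓ (F4 ✗)     | ✓          |
| `W_RK4`                                     | ✓          | ✓            | ✓          |
| N1 `Fact_cupExterior`                       | ✓          | ✓            | **✗**      |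
| `PohlmannSpan` (open input `pohlmann_span`) | ✓          | ✓            | **✗**      |
| `HC_CM` (COR-CM)                            | ✓          | ✗            | ✗          |
| `OpenInputs`                                | ✗          | ✗            | ✗          |

Consequences (the point of part (6a)(ii) for the input `pohlmann_span`, the one field of `OpenInputs` for which the
lineage had no separating model — TOY2-G3.md §3):

* `pohlmannSpan_independent` — **the open input `pohlmann_span` carries content**: `ModelAxioms ∧ N2 ∧ N3 ∧ N4 ∧
  Fact_dimProd ∧ W_RK4` has models with BOTH truth values of `PohlmannSpan`;
* `not_pohlmannSpan_of_modelAxioms_N234` — Pohlmann's span theorem is NOT a consequence of the 28 model facts and the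
  textbook facts N2–N4 (so in `pohlmannSpan_of_facts (M) (hN1) (hN2) (hN3) (hN4)` the input N1 `Fact_cupExterior` —
  `H^• = ⋀^• H¹` — cannot be dropped: `fact_cupExterior_independent`);
* `padModel_ne_toyModel`, `padModel_ne_truncModel` — a third model of the 28 facts (part (6a)(i)).

Nothing is cited; Lean + Mathlib axioms only (`#print axioms` = `propext, Classical.choice, Quot.sound`).
-/

noncomputable section

namespace HodgeCM.Toy

open Universe

/-- **The padded toy universe** `toyModel♯`: `H⁶ ↦ H⁶ ⊕ H⁶` (pad purely of type `(3,3)`, not algebraic). -/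
def padModel : Universe := toyModel.padH6

/-- (Ported verbatim from the HodgeCMPerL package; no docstring in the source.) -/
theorem padModel_def : padModel = toyModel.padH6 := rfl

/-- (Ported verbatim from the HodgeCMPerL package; no docstring in the source.) -/
theorem padModel_modelAxioms : padModel.ModelAxioms := PadH6.modelAxioms toyModel_modelAxioms toyModel_fact_dimProd

/-- (Ported verbatim from the HodgeCMPerL package; no docstring in the source.) -/
theorem padModel_fact_cup_hodge : padModel.Fact_cup_hodge := PadH6.fact_cup_hodge toyModel_fact_cup_hodge

/-- (Ported verbatim from the HodgeCMPerL package; no docstring in the source.) -/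
theorem padModel_fact_pull_H0 : padModel.Fact_pull_H0 := PadH6.fact_pull_H0_iff.mpr toyModel_fact_pull_H0

/-- (Ported verbatim from the HodgeCMPerL package; no docstring in the source.) -/
theorem padModel_fact_hodge_F0 : padModel.Fact_hodge_F0 := PadH6.fact_hodge_F0 toyModel_fact_hodge_F0

/-- (Ported verbatim from the HodgeCMPerL package; no docstring in the source.) -/
theorem padModel_fact_dimProd : padModel.Fact_dimProd := PadH6.fact_dimProd_iff.mpr toyModel_fact_dimProd

/-- (Ported verbatim from the HodgeCMPerL package; no docstring in the source.) -/
theorem padModel_fact_cupAssoc : padModel.Fact_cupAssoc := PadH6.fact_cupAssoc (fact_cupAssoc exteriorHodgeData)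

/-- (Ported verbatim from the HodgeCMPerL package; no docstring in the source.) -/
theorem padModel_fact_cupAlg : padModel.Fact_cupAlg := PadH6.fact_cupAlg fact_cupAlg

/-- (Ported verbatim from the HodgeCMPerL package; no docstring in the source.) -/
theorem padModel_w_rk4 : padModel.W_RK4 := PadH6.w_RK4_iff.mpr toyModel_w_rk4

/-- **Pohlmann's span theorem FAILS in `padModel`.** -/
theorem not_padModel_pohlmannSpan : ¬ padModel.PohlmannSpan :=
  PadH6.not_pohlmannSpan toyModel_modelAxioms toyModel_fact_cupExterior

/-- **N1 FAILS in `padModel`.** -/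
theorem not_padModel_fact_cupExterior : ¬ padModel.Fact_cupExterior :=
  PadH6.not_fact_cupExterior toyModel_modelAxioms toyModel_fact_dimProd toyModel_fact_cupExterior toyModel_fact_cup_hodge
    toyModel_fact_pull_H0 toyModel_fact_hodge_F0

/-- (Ported verbatim from the HodgeCMPerL package; no docstring in the source.) -/
theorem not_padModel_hc_cm : ¬ padModel.HC_CM := PadH6.not_hc_cm toyModel_modelAxioms toyModel_fact_cupExterior

/-- (Ported verbatim from the HodgeCMPerL package; no docstring in the source.) -/
theorem not_padModel_openInputs : ¬ padModel.OpenInputs :=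
  PadH6.not_openInputs toyModel_modelAxioms toyModel_fact_cupExterior

/-- **The truth table of `padModel`.** -/
theorem padModel_profile :
    (padModel.ModelAxioms ∧ padModel.Fact_cup_hodge ∧ padModel.Fact_pull_H0 ∧ padModel.Fact_hodge_F0 ∧
        padModel.Fact_dimProd ∧ padModel.Fact_cupAssoc ∧ padModel.Fact_cupAlg ∧ padModel.W_RK4) ∧
      (¬ padModel.Fact_cupExterior ∧ ¬ padModel.PohlmannSpan ∧ ¬ padModel.HC_CM ∧ ¬ padModel.OpenInputs) :=
  ⟨⟨padModel_modelAxioms, padModel_fact_cup_hodge, padModel_fact_pull_H0, padModel_fact_hodge_F0, padModel_fact_dimProd,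
      padModel_fact_cupAssoc, padModel_fact_cupAlg, padModel_w_rk4⟩,
    ⟨not_padModel_fact_cupExterior, not_padModel_pohlmannSpan, not_padModel_hc_cm, not_padModel_openInputs⟩⟩

/-! ### Independence / separation statements -/

/-- **`PohlmannSpan` is independent of `ModelAxioms ∧ N2 ∧ N3 ∧ N4 ∧ Fact_dimProd ∧ W_RK4`**: both truth values occur
(`toyModel`: true; `padModel`: false). -/
theorem pohlmannSpan_independent :
    (∃ U : Universe, U.ModelAxioms ∧ U.Fact_cup_hodge ∧ U.Fact_pull_H0 ∧ U.Fact_hodge_F0 ∧ U.Fact_dimProd ∧ U.W_RK4 ∧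
        U.PohlmannSpan) ∧
      ∃ U : Universe, U.ModelAxioms ∧ U.Fact_cup_hodge ∧ U.Fact_pull_H0 ∧ U.Fact_hodge_F0 ∧ U.Fact_dimProd ∧ U.W_RK4 ∧
        ¬ U.PohlmannSpan :=
  ⟨⟨toyModel, toyModel_modelAxioms, toyModel_fact_cup_hodge, toyModel_fact_pull_H0, toyModel_fact_hodge_F0,
      toyModel_fact_dimProd, toyModel_w_rk4, toyModel_pohlmannSpan'⟩,
    ⟨padModel, padModel_modelAxioms, padModel_fact_cup_hodge, padModel_fact_pull_H0, padModel_fact_hodge_F0,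
      padModel_fact_dimProd, padModel_w_rk4, not_padModel_pohlmannSpan⟩⟩

/-- **The open input `pohlmann_span` is not a consequence of the 28 model facts and N2–N4** (nor of `Fact_dimProd`,
F4, F5 and `W_RK4` on top). -/
theorem not_pohlmannSpan_of_modelAxioms_N234 :
    ¬ ∀ U : Universe, U.ModelAxioms → U.Fact_cup_hodge → U.Fact_pull_H0 → U.Fact_hodge_F0 → U.Fact_dimProd →
      U.Fact_cupAlg → U.Fact_cupAssoc → U.W_RK4 → U.PohlmannSpan :=
  fun h => not_padModel_pohlmannSpan
    (h padModel padModel_modelAxioms padModel_fact_cup_hodge padModel_fact_pull_H0 padModel_fact_hodge_F0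
      padModel_fact_dimProd padModel_fact_cupAlg padModel_fact_cupAssoc padModel_w_rk4)

/-- **N1 `Fact_cupExterior` is independent of the 28 model facts and N2–N4**: in `pohlmannSpan_of_facts` it cannot be
dropped. -/
theorem fact_cupExterior_independent :
    (∃ U : Universe, U.ModelAxioms ∧ U.Fact_cup_hodge ∧ U.Fact_pull_H0 ∧ U.Fact_hodge_F0 ∧ U.Fact_cupExterior) ∧
      ∃ U : Universe, U.ModelAxioms ∧ U.Fact_cup_hodge ∧ U.Fact_pull_H0 ∧ U.Fact_hodge_F0 ∧ ¬ U.Fact_cupExterior :=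
  ⟨⟨toyModel, toyModel_modelAxioms, toyModel_fact_cup_hodge, toyModel_fact_pull_H0, toyModel_fact_hodge_F0,
      toyModel_fact_cupExterior⟩,
    ⟨padModel, padModel_modelAxioms, padModel_fact_cup_hodge, padModel_fact_pull_H0, padModel_fact_hodge_F0,
      not_padModel_fact_cupExterior⟩⟩

/-- The unconditional instance of `HodgeCM.Universe.exists_model_not_pohlmannSpan`. -/
theorem exists_model_not_pohlmannSpan' :
    ∃ U : Universe, U.ModelAxioms ∧ U.Fact_cup_hodge ∧ U.Fact_pull_H0 ∧ U.Fact_hodge_F0 ∧ U.Fact_dimProd ∧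
      ¬ U.PohlmannSpan ∧ ¬ U.Fact_cupExterior ∧ ¬ U.OpenInputs ∧ ¬ U.HC_CM :=
  exists_model_not_pohlmannSpan ⟨toyModel, toyModel_modelAxioms, toyModel_fact_cupExterior, toyModel_fact_cup_hodge,
    toyModel_fact_pull_H0, toyModel_fact_hodge_F0, toyModel_fact_dimProd⟩

/-- **A third model of the 28 facts** (part (6a)(i)): `padModel` differs from `toyModel` (N1) and from `truncModel` (N1). -/
theorem padModel_ne_toyModel : padModel ≠ toyModel := fun h => not_padModel_fact_cupExterior (h ▸ toyModel_fact_cupExterior)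

/-- (Ported verbatim from the HodgeCMPerL package; no docstring in the source.) -/
theorem padModel_ne_truncModel : padModel ≠ truncModel := fun h =>
  not_padModel_fact_cupExterior (h ▸ truncModel_fact_cupExterior)

/-- (Ported verbatim from the HodgeCMPerL package; no docstring in the source.) -/
theorem exists_three_models :
    ∃ U₁ U₂ U₃ : Universe, U₁.ModelAxioms ∧ U₂.ModelAxioms ∧ U₃.ModelAxioms ∧ U₁ ≠ U₂ ∧ U₂ ≠ U₃ ∧ U₁ ≠ U₃ :=
  ⟨toyModel, truncModel, padModel, toyModel_modelAxioms, truncModel_modelAxioms, padModel_modelAxioms,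
    truncModel_ne_toyModel.symm, padModel_ne_truncModel.symm, padModel_ne_toyModel.symm⟩

end HodgeCM.Toy

end
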